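import Summits.BirchSwinnertonDyer.BirchSwinnertonDyer.Theorems.GenusKolyvaginAtTwoMinimalTwinBSDTwoOddCutFrobeniusFrameDoor
import HarnessLib

/-!
# Route `GenusKolyvaginAtTwo`, crux U₂ `MinimalTwinBSDTwo` (stmt-BirchSwinnertonDyer-22985), LINE 23 «twin_swap» — NVFROB IS BSD-NECESSARY MODULO THE
# ANALYTIC FRAME: granted `BSD₂` of the curve and of its budget twin, NVFROB's data at `W` ARE «an odd datum on 4 ∣ N» + «one Heegner field with
# `L(W^{(d_K)},1) ≠ 0` and the Frobenius conditions on the prime factors of `d_K`»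

Seat `bsd-line-gk2-p2` g33 (PROVER seat 2/3, cell `bsd-f1-sign2`, LINE 23 holder), `--supports stmt-BirchSwinnertonDyer-22985 --as helper`.
THEOREMS ONLY (no definition, no named fact, no `sorry`).  BSD is NOT proved by any of this; U₂ is NOT proved; nothing is closed.

WHAT.  p818537 reduced LINE 23's on-cut branch to WALL + PRINT + AU + Čes + Q2 + NVFROB + WITNESS_{dc,≥2}.  This file runs the frame leaf BACKWARDS from
BSD: at a curve `W` of the odd habitat cut with `#Sel₂(W) = 2` and analytic rank `1`, IF `BSD₂(W)` holds and `BSD₂` holds for the rank-`0` non-CM twists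
(WALL row 1), then NVFROB's data at `W` follow from (i) an odd datum when `4 ∣ N_W` and (ii) ONE imaginary quadratic Heegner `K` (`d_K` odd `≠ −3`) with
`L(W^{(d_K)},1) ≠ 0` whose ramified primes avoid the totally split class of `ℚ(W[2])` and meet the transposition class at most `𝟙[Δ_W < 0]` times —
the door clause being FORCED (`doorClause_of_bsdp_pair`, p818043 §3, on the budget twin model of p818162, transported to the twist by `#Sel₂`
model-invariance).  So the frame leaf is BSD-CONSISTENT exactly when the purely analytic-Chebotarev statement (ii) holds: THAT is research content (A)
of the census (twist non-vanishing inside a Chebotarev class of discriminants; prime frames automatic budget, p813652; class-wide not in print).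
* `frobeniusFrameDoor_of_bsdp_of_analyticFrobeniusFrame` — per curve.
* `frobeniusFrameDoorSupply_of_bsd_of_analyticFrobeniusFrameSupply` — supply form: (rank-one `BSD₂` on the cut) + WALL row 1 + (4 ∣ N → odd datum) +
  ANALYTIC-FROBENIUS-FRAME-supply ⟹ NVFROB-supply.  With p818537 this brackets U₂|cut between «WALL + PRINT + Q2 + (A) + (B)» (sufficient) and
  «(A) is necessary for the LINE given BSD» (this file) — (B) = WITNESS_{dc,≥2} / door-open `2`-primitivity.

HONEST FRAMING.  CONDITIONAL (the BSD₂ hypotheses are the crux itself: this is a CONSISTENCY certificate, not progress on U₂); nothing beyond print;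
BSD is NOT proved.

References: [Kramer1981] Prop. 3; [GrossZagier1986] V.§2 (2.2); [Kolyvagin1989Izv] Thm. A.
-/

set_option autoImplicit false
set_option linter.dupNamespace false -- `Summit.<P>.<Sub>` repeats `BirchSwinnertonDyer` (D-0017)

noncomputable section

open scoped Classical NumberField

namespace Summit.BirchSwinnertonDyer.BirchSwinnertonDyer.Theorems.GenusExact.TwinSwap.TwinAnnihilation

open Literature.NumberTheory.EllipticCurves Literature.NumberTheory.GaloisRepresentations WeierstrassCurve NumberField
  IsDedekindDomain Field AddSubgroup Literature.NumberTheory.EllipticCurves.ModularForms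
open Summit.BirchSwinnertonDyer.Rank1Residual
open Summit.BirchSwinnertonDyer.BirchSwinnertonDyer.Theorems.GenusExact.TwinSwap.GenusBudget (exists_budgetTwinModel_of_frobenius)

/-- **NVFROB's data at one curve from `BSD₂` of the pair and the analytic Frobenius frame.**  `W` globally minimal of analytic rank `1` with `#Sel₂(W) = 2`,
`C(W)` odd, `ρ̄_{W,2}` onto, `BSD₂(W)`; `K` imaginary quadratic Heegner with `d_K` odd `≠ −3`, `L(W^{(d_K)},1) ≠ 0` and the Frobenius conditions on the
prime factors of `d_K`; `BSD₂` for every non-CM globally minimal curve of analytic rank `0` (WALL row 1, used for the budget twin).  Then the door clause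
holds on the twist: `#Sel₂(W^{(d_K)}) ≠ 1 ∨` (`P(1) ∉ 2W(K[1])` for every odd datum and conductor-`1` Heegner datum).  Modulo GZ + GZK + modularity + Milne.
CONDITIONAL; BSD is NOT proved. [cite: GrossZagier1986, V.§2 (2.2)] [cite: Kramer1981, Prop. 3] -/
theorem frobeniusFrameDoor_of_bsdp_of_analyticFrobeniusFrame
    (hGZ : ∀ (N : ℕ) [NeZero N] (W : WeierstrassCurve ℚ) (K : Type) [Field K] [NumberField K], gross_zagier N W K)
    (hGZK : rank_eq_analyticRank_of_analyticRank_le_one) (hmod : hasEntireLFunction_rat)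
    (hMilneC : Milne1972.bsdQuotient_baseChange_quadratic_anyModel)
    (hS1 : ∀ (W : WeierstrassCurve ℚ) [W.IsElliptic] [W.IsGloballyMinimal], ¬ W.HasCM → W.analyticRank = 0 → BSDp W 2)
    (W : WeierstrassCurve ℚ) [W.IsElliptic] [W.IsGloballyMinimal] [NeZero (W.conductorNorm ℤ)] (hcm : ¬ W.HasCM)
    (hr : W.analyticRank = 1) (hSel : Nat.card (W.selmerGroup 2) = 2) (hT : Odd W.tamagawaProduct) (hs2 : W.HasSurjectiveModNGaloisRep 2)
    (hBW : BSDp W 2)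
    (K : Type) [Field K] [NumberField K] (hK : IsImaginaryQuadratic K) (hodd : Odd (NumberField.discr K))
    (h3 : NumberField.discr K ≠ -3) (hH : SatisfiesHeegnerHypothesis (W.conductorNorm ℤ) K)
    (hLv : (W.quadraticTwist (NumberField.discr K : ℚ)).entireLFunction 1 ≠ 0)
    (hno3 : ∀ q ∈ (NumberField.discr K).natAbs.primeFactors, ¬ (jacobiSym W.Δ.num q = 1 ∧ Even (W.frobeniusTrace q)))
    (hcount : ((NumberField.discr K).natAbs.primeFactors.filter (fun q ↦ jacobiSym W.Δ.num q = -1)).card ≤ if W.Δ < 0 then 1 else 0)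
    [(W.quadraticTwist (NumberField.discr K : ℚ)).IsElliptic] :
    Nat.card ((W.quadraticTwist (NumberField.discr K : ℚ)).selmerGroup 2) ≠ 1 ∨
      ∀ (Dt : ModularParametrizationData W (W.conductorNorm ℤ)), Odd Dt.c → ∀ (β : ℤ) (ι : K →+* ℂ) (d₁ : KolyvaginHeegnerData Dt β ι 1),
        ¬ ∃ Q : (W.baseChange (ringClassField K ι 1)).toAffine.Point, (2 : ℤ) • Q = d₁.derivedPoint := by
  -- the budget twin model and `BSD₂` for it (non-CM of analytic rank `0`)
  obtain ⟨Wd, iE, iM, ⟨Cd, hCd⟩, hbudget⟩ := exists_budgetTwinModel_of_frobenius W K hK hodd hH hT hno3 hcount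
  have hD0 : (NumberField.discr K : ℚ) ≠ 0 := by exact_mod_cast NumberField.discr_ne_zero K
  have hcmd : ¬ Wd.HasCM := by
    rw [← hCd, hasCM_iff_of_j_eq (((W.quadraticTwist (NumberField.discr K : ℚ)).variableChange_j Cd).trans (W.j_quadraticTwist hD0))]
    exact hcm
  have hrd : Wd.analyticRank = 0 := by
    rw [← hCd, analyticRank_smul]
    exact ((W.quadraticTwist (NumberField.discr K : ℚ)).analyticRank_eq_zero_iff_holds (hmod _)).mpr hLv
  have hBd : BSDp Wd 2 := hS1 Wd hcmd hrd
  -- the door clause on `Wd`, forced by BSD₂ of the pair, transported to the twist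
  have hdoor := doorClause_of_bsdp_pair hGZ hGZK hmod hMilneC W hr hSel hT hs2 K hK hodd h3 hH hLv Wd ⟨Cd, hCd⟩ hbudget hBW hBd
  rcases hdoor with hdc | hprim
  · left
    have h := natCard_selmerGroup_smul (W.quadraticTwist (NumberField.discr K : ℚ)) Cd (n := 2) two_ne_zero
    simp only [Nat.cast_ofNat] at h
    rw [← h, hCd]
    exact hdc
  · exact Or.inr hprim

/-- **NVFROB-supply from rank-one `BSD₂` on the cut + WALL row 1 + the Manin datum on `4 ∣ N` + the ANALYTIC FROBENIUS FRAME supply** (supply form of the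
above): the research leaf NVFROB of LINE 23 (p818537's `hNVF`) is BSD-NECESSARY modulo the purely analytic-Chebotarev supply «per `W` on the cut, one
imaginary quadratic Heegner `K` (`d_K` odd `≠ −3`) with `L(W^{(d_K)},1) ≠ 0`, no prime factor of `d_K` totally split in `ℚ(W[2])`, at most `𝟙[Δ_W < 0]`
transposition prime factors» (`hA`) and the Manin supply on `v₂(N_W) ≥ 2` (`hManin`).  A CONSISTENCY certificate for the line (its hypotheses include the
crux); BSD is NOT proved. [cite: GrossZagier1986, V.§2 (2.2)] [cite: Kramer1981, Prop. 3] -/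
theorem frobeniusFrameDoorSupply_of_bsd_of_analyticFrobeniusFrameSupply
    (hGZ : ∀ (N : ℕ) [NeZero N] (W : WeierstrassCurve ℚ) (K : Type) [Field K] [NumberField K], gross_zagier N W K)
    (hGZK : rank_eq_analyticRank_of_analyticRank_le_one) (hmod : hasEntireLFunction_rat)
    (hMilneC : Milne1972.bsdQuotient_baseChange_quadratic_anyModel)
    (hS1 : ∀ (W : WeierstrassCurve ℚ) [W.IsElliptic] [W.IsGloballyMinimal], ¬ W.HasCM → W.analyticRank = 0 → BSDp W 2)
    (hU2cut : ∀ (W : WeierstrassCurve ℚ) [W.IsElliptic] [W.IsGloballyMinimal] [NeZero (W.conductorNorm ℤ)],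
      ¬ W.HasCM → W.analyticRank = 1 → Nat.card (W.selmerGroup 2) = 2 → Odd W.tamagawaProduct →
      (∀ n : ℕ, 0 < n → W.HasSurjectiveModNGaloisRep ((2 : ℤ) ^ n)) →
      (∃ v : HeightOneSpectrum (𝓞 ℚ), ((2 : ℕ) : 𝓞 ℚ) ∉ v.asIdeal ∧ ((W.conductorNorm ℤ : ℕ) : 𝓞 ℚ) ∈ v.asIdeal ∧ W.HasMultiplicativeReductionAt v) →
      BSDp W 2)
    (hManin : ∀ (W : WeierstrassCurve ℚ) [W.IsElliptic] [W.IsGloballyMinimal] [NeZero (W.conductorNorm ℤ)],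
      ¬ W.HasCM → W.analyticRank = 1 → Nat.card (W.selmerGroup 2) = 2 → 4 ∣ W.conductorNorm ℤ →
      ∃ Dt : ModularParametrizationData W (W.conductorNorm ℤ), Odd Dt.c)
    (hA : ∀ (W : WeierstrassCurve ℚ) [W.IsElliptic] [W.IsGloballyMinimal] [NeZero (W.conductorNorm ℤ)],
      ¬ W.HasCM → W.analyticRank = 1 → Nat.card (W.selmerGroup 2) = 2 → Odd W.tamagawaProduct →
      (∀ n : ℕ, 0 < n → W.HasSurjectiveModNGaloisRep ((2 : ℤ) ^ n)) →
      (∃ v : HeightOneSpectrum (𝓞 ℚ), ((2 : ℕ) : 𝓞 ℚ) ∉ v.asIdeal ∧ ((W.conductorNorm ℤ : ℕ) : 𝓞 ℚ) ∈ v.asIdeal ∧ W.HasMultiplicativeReductionAt v) →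
      ∃ (K : Type) (_ : Field K) (_ : NumberField K), IsImaginaryQuadratic K ∧ Odd (NumberField.discr K) ∧ NumberField.discr K ≠ -3 ∧
        SatisfiesHeegnerHypothesis (W.conductorNorm ℤ) K ∧ (W.quadraticTwist (NumberField.discr K : ℚ)).entireLFunction 1 ≠ 0 ∧
        (∀ q ∈ (NumberField.discr K).natAbs.primeFactors, ¬ (jacobiSym W.Δ.num q = 1 ∧ Even (W.frobeniusTrace q))) ∧
        ((NumberField.discr K).natAbs.primeFactors.filter (fun q ↦ jacobiSym W.Δ.num q = -1)).card ≤ (if W.Δ < 0 then 1 else 0)) :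
    ∀ (W : WeierstrassCurve ℚ) [W.IsElliptic] [W.IsGloballyMinimal] [NeZero (W.conductorNorm ℤ)],
      ¬ W.HasCM → W.analyticRank = 1 → Nat.card (W.selmerGroup 2) = 2 → Odd W.tamagawaProduct →
      (∀ n : ℕ, 0 < n → W.HasSurjectiveModNGaloisRep ((2 : ℤ) ^ n)) →
      (∃ v : HeightOneSpectrum (𝓞 ℚ), ((2 : ℕ) : 𝓞 ℚ) ∉ v.asIdeal ∧ ((W.conductorNorm ℤ : ℕ) : 𝓞 ℚ) ∈ v.asIdeal ∧ W.HasMultiplicativeReductionAt v) →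
      (4 ∣ W.conductorNorm ℤ → ∃ Dt : ModularParametrizationData W (W.conductorNorm ℤ), Odd Dt.c) ∧
      ∃ (K : Type) (_ : Field K) (_ : NumberField K), IsImaginaryQuadratic K ∧ Odd (NumberField.discr K) ∧ NumberField.discr K ≠ -3 ∧
        SatisfiesHeegnerHypothesis (W.conductorNorm ℤ) K ∧ (W.quadraticTwist (NumberField.discr K : ℚ)).entireLFunction 1 ≠ 0 ∧
        (∀ q ∈ (NumberField.discr K).natAbs.primeFactors, ¬ (jacobiSym W.Δ.num q = 1 ∧ Even (W.frobeniusTrace q))) ∧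
        ((NumberField.discr K).natAbs.primeFactors.filter (fun q ↦ jacobiSym W.Δ.num q = -1)).card ≤ (if W.Δ < 0 then 1 else 0) ∧
        ∃ (_ : (W.quadraticTwist (NumberField.discr K : ℚ)).IsElliptic),
          (Nat.card ((W.quadraticTwist (NumberField.discr K : ℚ)).selmerGroup 2) ≠ 1 ∨
            ∀ (Dt : ModularParametrizationData W (W.conductorNorm ℤ)), Odd Dt.c → ∀ (β : ℤ) (ι : K →+* ℂ) (d₁ : KolyvaginHeegnerData Dt β ι 1),
              ¬ ∃ Q : (W.baseChange (ringClassField K ι 1)).toAffine.Point, (2 : ℤ) • Q = d₁.derivedPoint) := by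
  intro W _ _ _ hcm hr hSel hT hρ hv
  obtain ⟨K, iF, iN, hK, hodd, h3, hH, hLv, hno3, hcount⟩ := hA W hcm hr hSel hT hρ hv
  have hBW : BSDp W 2 := hU2cut W hcm hr hSel hT hρ hv
  have hs2 : W.HasSurjectiveModNGaloisRep 2 := by simpa using hρ 1 one_pos
  have hD0 : (NumberField.discr K : ℚ) ≠ 0 := by exact_mod_cast NumberField.discr_ne_zero K
  haveI iT : (W.quadraticTwist (NumberField.discr K : ℚ)).IsElliptic := W.isElliptic_quadraticTwist hD0
  refine ⟨fun h4 ↦ hManin W hcm hr hSel h4, K, iF, iN, hK, hodd, h3, hH, hLv, hno3, hcount, iT, ?_⟩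
  exact frobeniusFrameDoor_of_bsdp_of_analyticFrobeniusFrame hGZ hGZK hmod hMilneC hS1 W hcm hr hSel hT hs2 hBW K hK hodd h3 hH hLv hno3 hcount

end Summit.BirchSwinnertonDyer.BirchSwinnertonDyer.Theorems.GenusExact.TwinSwap.TwinAnnihilation

end
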